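import Literature.NumberTheory.GaloisRepresentations.GlobalArtinMapSecondInequalityProofs
import Literature.NumberTheory.GaloisRepresentations.LocalWeilDatum
import Mathlib.LinearAlgebra.Complex.Module
import HarnessLib

/-!
# Hasse's norm theorem for cyclic extensions: the local conditions at the archimedean places

Topic `NumberTheory/GaloisRepresentations` (global class field theory); namespace
`Literature.NumberTheory.GaloisRepresentations.ArchHerbrand` (continuing `ArchimedeanHerbrand.lean`
and the archimedean section of `GlobalArtinMapSecondInequalityProofs.lean`).  Proof file: theorems
only (no definition, no instance, no named fact; D-0026).

The archimedean input of Hasse's norm theorem for a Galois extension `E/K` of number fields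
(Cassels–Fröhlich VII §9.6, with Childress Prop. 5.7 (ii) for the computation at the infinite
places): the part of the principal idele `(a)_∞` above an infinite place `u` of `K` is a Galois norm
`∏_{g ∈ Gal(E/K)} g • Y` from `∏_{w∣u} E_wˣ`, provided either the places above `u` are unramified, or
`u` is real and `u(a) > 0`.  The file also translates the cohomological form of the local condition
("inside `K̄_u`, `a` is a norm from the layer `K_u(E)`") into this dichotomy:

* `exists_infUnits_norm_eq_of_forall_isUnramified` — free orbits (all `w ∣ u` unramified): every
  fixed idele above `u` is a norm (as `exists_infUnits_norm_eq_of_isComplex`, complex `u`);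
* `extensionEmbedding_algebraMap_of_isReal`, `restrictTo_infHom_principal_mem_posReal`,
  `smul_restrictTo_infHom_principal`, `exists_infUnits_norm_eq_restrictTo_principal` — for `u` real
  with `u(a) > 0` the part of `(a)` above `u` lies in `∏_{w∣u} ℝ_{>0}`, hence is a norm
  (`exists_posReal_norm_eq_of_forall_smul_eq`);
* `forall_isUnramified_of_forall_mem_range` — **dictionary**: if `E` lands in `K_u` inside `K̄_u`
  (along the chosen `K̄ → K̄_u`), every place of `E` above `u` is unramified (the induced
  `E → K_u → ℂ` is a real place over a real `u`; the others are its conjugates);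
* `surjective_algHom_complex` — a `K_u`-algebra map `K̄_u → ℂ` over the embedding of `u` is onto
  (`ℂ` is integral over the algebraically closed `K̄_u`); `embedding_re_pos_of_prod_smul_eq` —
  **positivity**: if `a = ∏_{k<n} sᵏ • b` in `K̄_u` with `n ≥ 2` and the `sᵏ` distinct modulo a
  subgroup, then `u(a) > 0` (transport to `ℂ`: `Φ s Φ⁻¹` is an `ℝ`-automorphism of `ℂ` other than
  the identity, i.e. complex conjugation, Mathlib `Complex.real_algHom_eq_id_or_conj`; so `n = 2`
  and `u(a) = |Φ b|²`);
* `exists_infUnits_norm_eq_of_local` — the archimedean local condition of the completion form of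
  Hasse's norm theorem (`IdeleHerbrand.hasseNorm_of_local`, `HasseNormCyclicCompletion.lean`) from
  the cohomological data `(n, s, b)` at `u`.

## References

* J. W. S. Cassels, A. Fröhlich (eds.), *Algebraic Number Theory* (1967), Ch. VII (J. Tate) §9.6,
  Ch. II (Cassels) §10, Ch. VII §1.1. [CasselsFrohlichANT1967]
* N. Childress, *Class Field Theory*, Universitext (2009), Ch. 4 §5 Prop. 5.7 (ii). [Childress2009]
-/

noncomputable section

open NumberField NumberField.InfinitePlace IsDedekindDomain

namespace Literature.NumberTheory.GaloisRepresentations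

namespace ArchHerbrand

open Literature.NumberTheory.Automorphic IdeleHerbrand

universe u

variable {K : Type u} [Field K] [NumberField K] {E : Type u} [Field E] [NumberField E] [Algebra K E]
variable [IsGalois K E]

/-! ### Free orbits: every fixed idele above an unramified infinite place is a Galois norm -/

/-- **Unramified infinite places: a `Gal(E/K)`-fixed archimedean idele supported above `u` is a
Galois norm** when the places above `u` are unramified — they then form a free `Gal(E/K)`-orbit
(the stabiliser of an unramified place is trivial), so the idele with the component `x_{w₀}` at one
place `w₀ ∣ u` and `1` elsewhere has norm `x` (same proof as the complex case
`exists_infUnits_norm_eq_of_isComplex`).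
[cite: Childress2009, Ch. 4 §5 Prop. 5.7 (ii) (proof, PDF pp. 98–99)] -/
theorem exists_infUnits_norm_eq_of_forall_isUnramified {u : InfinitePlace K}
    (hunr : ∀ w : InfinitePlace E, IsOver E u w → w.IsUnramified K)
    {x : (InfiniteAdeleRing E)ˣ} (hx : x ∈ infUnits E u) (hfix : ∀ g : E ≃ₐ[K] E, g • x = x) :
    ∃ Y ∈ infUnits E u, Herbrand.norm (E ≃ₐ[K] E) Y = x := by
  classical
  set w₀ := placeOver E u
  have hw₀ : IsOver E u w₀ := isOver_placeOver u
  have hstab : ∀ g : E ≃ₐ[K] E, g • w₀ = w₀ → g = 1 := by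
    intro g hg
    have hmem : g ∈ MulAction.stabilizer (E ≃ₐ[K] E) w₀ := hg
    rwa [(hunr w₀ hw₀).stabilizer_eq_bot, Subgroup.mem_bot] at hmem
  set z : w₀.Completion := (x : InfiniteAdeleRing E) w₀
  have hz : z ≠ 0 := apply_ne_zero x w₀
  have key : ∀ w : InfinitePlace E, w = w₀ →
      (unitSingle w₀ z hz : InfiniteAdeleRing E) w = (x : InfiniteAdeleRing E) w := by
    rintro w rfl
    exact unitSingle_apply_self w₀ z hz
  refine ⟨unitSingle w₀ z hz,
    fun w hw => unitSingle_apply_of_ne w₀ z hz (fun h => hw (by rw [h]; exact hw₀)), ?_⟩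
  apply Units.ext
  funext w'
  rw [Herbrand.norm_apply, Units.coe_prod, prod_apply']
  by_cases hw' : IsOver E u w'
  · obtain ⟨g₀, hg₀⟩ := exists_smul_eq_of_isOver hw₀ hw'
    have hinv : g₀⁻¹ • w' = w₀ := by rw [← hg₀, inv_smul_smul]
    rw [Finset.prod_eq_single g₀]
    · conv_rhs => rw [← hfix g₀]
      rw [smul_units_apply, smul_units_apply, key _ hinv]
    · intro g _ hne
      rw [smul_units_apply, unitSingle_apply_of_ne w₀ z hz, map_one]
      intro h
      apply hne
      have h' : g • w₀ = w' := by rw [← h, smul_inv_smul]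
      have hgg : (g₀⁻¹ * g) • w₀ = w₀ := by rw [mul_smul, h', hinv]
      have := hstab _ hgg
      rw [inv_mul_eq_one] at this
      exact this.symm
    · intro h
      exact absurd (Finset.mem_univ g₀) h
  · rw [hx w' hw']
    refine Finset.prod_eq_one fun g _ => ?_
    rw [smul_units_apply, unitSingle_apply_of_ne w₀ z hz, map_one]
    intro h
    apply hw'
    have : IsOver E u (g⁻¹ • w') := by rw [h]; exact hw₀
    exact (isOver_smul_iff g⁻¹).mp this

/-! ### The archimedean part of a principal idele -/

omit [IsGalois K E] in
/-- Components of the archimedean part of the principal idele of `k ∈ Eˣ`. [folklore] -/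
theorem infHom_principal_apply (k : Eˣ) (w : InfinitePlace E) :
    ((infHom E (principal E k) : (InfiniteAdeleRing E)ˣ) : InfiniteAdeleRing E) w =
      ((k : E) : w.Completion) :=
  rfl

omit [IsGalois K E] [NumberField K] in
/-- The archimedean part of the principal idele of `a ∈ Kˣ`, above `u`, is `Gal(E/K)`-fixed. [folklore] -/
theorem smul_restrictTo_infHom_principal (u : InfinitePlace K) (a : Kˣ) (g : E ≃ₐ[K] E) :
    g • restrictTo (F := K) u (infHom E (principal E (CyclicNormIndex.unitsIncl K E a))) =
      restrictTo (F := K) u (infHom E (principal E (CyclicNormIndex.unitsIncl K E a))) := by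
  rw [← restrictTo_smul, ← infHom_smul, ← principal_smul, CyclicNormIndex.smul_unitsIncl]

omit [IsGalois K E] [NumberField K] [NumberField E] in
/-- At a place `w ∣ u`, the embedding of `w` takes the value `u(a)` or its conjugate on `a ∈ K`;
for `u` real both are the real number `u(a)`. [folklore] -/
theorem extensionEmbedding_algebraMap_of_isReal {u : InfinitePlace K} (hu : u.IsReal)
    {w : InfinitePlace E} (hw : IsOver E u w) (a : K) :
    Completion.extensionEmbedding w ((algebraMap K E a : E) : w.Completion) = ((u.embedding a).re : ℂ) := by
  rw [extensionEmbedding_coe']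
  have hreal : ComplexEmbedding.IsReal u.embedding := isReal_iff.mp hu
  have hre : (u.embedding a : ℂ) = ((u.embedding a).re : ℂ) := by
    apply Complex.ext
    · simp
    · have := RingHom.congr_fun (ComplexEmbedding.isReal_iff.mp hreal) a
      rw [ComplexEmbedding.conjugate_coe_eq, Complex.conj_eq_iff_im] at this
      simp [this]
  have hmk : InfinitePlace.mk (w.embedding.comp (algebraMap K E)) = InfinitePlace.mk u.embedding := by
    rw [← comap_mk, mk_embedding, mk_embedding]
    exact hw
  rcases mk_eq_iff.mp hmk with h | h
  · rw [← hre, ← h]; rfl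
  · -- `u.embedding a` is real, and `conj (w.embedding a) = u.embedding a`
    have hfix := RingHom.congr_fun (ComplexEmbedding.isReal_iff.mpr hreal) a
    rw [← h] at hfix
    simp only [ComplexEmbedding.conjugate_coe_eq, RingHom.comp_apply, starRingEnd_self_apply] at hfix
    rw [← hre, ← h, ComplexEmbedding.conjugate_coe_eq, RingHom.comp_apply]
    exact hfix

omit [IsGalois K E] [NumberField K] in
/-- **For `u` real and `u(a) > 0`, the archimedean part of `(a)` above `u` lies in the positive real
lines `∏_{w∣u} ℝ_{>0}`.** [cite: Childress2009, Ch. 4 §5 Prop. 5.7 (ii)] -/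
theorem restrictTo_infHom_principal_mem_posReal {u : InfinitePlace K} (hu : u.IsReal) (a : Kˣ)
    (ha : 0 < (u.embedding (a : K)).re) :
    restrictTo (F := K) u (infHom E (principal E (CyclicNormIndex.unitsIncl K E a))) ∈ posReal E u := by
  refine ⟨restrictTo_mem_infUnits u _, fun w => ?_⟩
  by_cases hw : IsOver E u w
  · refine ⟨(u.embedding (a : K)).re, ha, ?_⟩
    rw [restrictTo_apply, if_pos hw, infHom_principal_apply]
    exact extensionEmbedding_algebraMap_of_isReal (E := E) hu hw (a : K)
  · refine ⟨1, one_pos, ?_⟩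
    rw [restrictTo_apply, if_neg hw, map_one, Complex.ofReal_one]

/-- **The archimedean local condition of the Hasse norm theorem.**  The part of `(a)_∞` above an
infinite place `u` of `K` is a Galois norm from `∏_{w∣u} E_wˣ` as soon as either the places above
`u` are unramified (free orbit), or `u` is real and `u(a) > 0` (positive reals are norms,
`exists_posReal_norm_eq_of_forall_smul_eq`). [cite: Childress2009, Ch. 4 §5 Prop. 5.7 (ii)] -/
theorem exists_infUnits_norm_eq_restrictTo_principal (u : InfinitePlace K) (a : Kˣ)
    (h : (∀ w : InfinitePlace E, IsOver E u w → w.IsUnramified K) ∨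
      (u.IsReal ∧ 0 < (u.embedding (a : K)).re)) :
    ∃ Y ∈ infUnits E u, Herbrand.norm (E ≃ₐ[K] E) Y =
      restrictTo (F := K) u (infHom E (principal E (CyclicNormIndex.unitsIncl K E a))) := by
  rcases h with hunr | ⟨hu, ha⟩
  · exact exists_infUnits_norm_eq_of_forall_isUnramified hunr (restrictTo_mem_infUnits u _)
      (smul_restrictTo_infHom_principal u a)
  · obtain ⟨Y, hY, hYu⟩ := exists_posReal_norm_eq_of_forall_smul_eq u
      (restrictTo_infHom_principal_mem_posReal (E := E) hu a ha) (smul_restrictTo_infHom_principal u a)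
    exact ⟨Y, posReal_le_infUnits u hY, hYu⟩

/-! ### The dictionary at an infinite place: `K_u(E) = K_u` means `u` is unramified in `E` -/

omit [NumberField K] [NumberField E] in
/-- **If `E` embeds into `K_u` (inside `K̄_u`, along the chosen `K̄ → K̄_u`), then every place of
`E` above `u` is unramified**: the induced embedding `E → K_u → ℂ` defines a place `w₀ ∣ u`, real if
`u` is real, and the other places above `u` are its Galois conjugates.
[cite: CasselsFrohlichANT1967, Ch. II §10, Ch. VII §1.1] -/
theorem forall_isUnramified_of_forall_mem_range (u : InfinitePlace K) (ιE : E →ₐ[K] AlgebraicClosure K)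
    (h : ∀ e : E, ∃ y : u.Completion, algebraMap u.Completion (AlgebraicClosure u.Completion) y =
      absClosureEmbedding K u.Completion (ιE e)) :
    ∀ w : InfinitePlace E, IsOver E u w → w.IsUnramified K := by
  classical
  choose τf hτf using h
  have hinj := (algebraMap u.Completion (AlgebraicClosure u.Completion)).injective
  -- `τ : E →+* K_u`
  have hτmul : ∀ x y, τf (x * y) = τf x * τf y := fun x y => hinj (by rw [map_mul, hτf, hτf, hτf, map_mul, map_mul])
  have hτadd : ∀ x y, τf (x + y) = τf x + τf y := fun x y => hinj (by rw [map_add, hτf, hτf, hτf, map_add, map_add])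
  have hτone : τf 1 = 1 := hinj (by rw [hτf, map_one, map_one, map_one])
  have hτzero : τf 0 = 0 := hinj (by rw [hτf, map_zero, map_zero, map_zero])
  let τ : E →+* u.Completion :=
    { toFun := τf, map_one' := hτone, map_mul' := hτmul, map_zero' := hτzero, map_add' := hτadd }
  have hτK : ∀ x : K, τ (algebraMap K E x) = (x : u.Completion) := by
    intro x
    apply hinj
    change algebraMap _ _ (τf _) = _
    rw [hτf, AlgHom.commutes, AlgHom.commutes]
    rfl
  -- the place `w₀ = mk (extensionEmbedding u ∘ τ)` lies over `u`
  set φ : E →+* ℂ := (Completion.extensionEmbedding u).comp τ with hφ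
  have hφK : φ.comp (algebraMap K E) = u.embedding := by
    ext x
    rw [RingHom.comp_apply, hφ, RingHom.comp_apply, hτK, extensionEmbedding_coe']
  have hover : IsOver E u (InfinitePlace.mk φ) := by
    change (InfinitePlace.mk φ).comap (algebraMap K E) = u
    rw [comap_mk, hφK, mk_embedding]
  -- `w₀` is unramified
  have hunr₀ : (InfinitePlace.mk φ).IsUnramified K := by
    rw [isUnramified_iff]
    rcases u.isReal_or_isComplex with hu | hu
    · left
      rw [isReal_mk_iff, ComplexEmbedding.isReal_iff]
      ext e
      rw [ComplexEmbedding.conjugate_coe_eq, hφ, RingHom.comp_apply,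
        ← Completion.extensionEmbeddingOfIsReal_apply hu, Complex.conj_ofReal]
    · right
      rwa [show (InfinitePlace.mk φ).comap (algebraMap K E) = u from hover]
  intro w hw
  obtain ⟨g, rfl⟩ := exists_smul_eq_of_isOver hover hw
  exact isUnramified_smul_iff.mpr hunr₀

/-! ### Positivity: a norm from a quadratic extension of a real `K_u` is positive -/

omit [NumberField K] [IsGalois K E] [NumberField E] in
/-- **A `K_u`-algebra homomorphism `K̄_u → ℂ` over the embedding of the real place `u` is onto**
(`ℂ` is algebraic over `ℝ = u(K_u)`: every `z` is a root of `X² − 2 Re(z) X + |z|²`, whose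
coefficients come from `K_u`; an algebraic extension of the algebraically closed `K̄_u` is trivial).
[folklore] -/
theorem surjective_algHom_complex (u : InfinitePlace K)
    (Φ : letI := (Completion.extensionEmbedding u).toAlgebra
      AlgebraicClosure u.Completion →ₐ[u.Completion] ℂ) :
    Function.Surjective Φ := by
  letI : Algebra u.Completion ℂ := (Completion.extensionEmbedding u).toAlgebra
  have hΦK : ∀ y : u.Completion, Φ (algebraMap u.Completion _ y) = Completion.extensionEmbedding u y :=
    fun y => Φ.commutes y
  have hint : Φ.toRingHom.IsIntegral := by
    intro z
    obtain ⟨y₁, hy₁⟩ := exists_extensionEmbedding_eq_ofReal u (2 * z.re)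
    obtain ⟨y₂, hy₂⟩ := exists_extensionEmbedding_eq_ofReal u (Complex.normSq z)
    refine ⟨Polynomial.X ^ 2 + (Polynomial.C (-algebraMap u.Completion _ y₁) * Polynomial.X +
      Polynomial.C (algebraMap u.Completion _ y₂)), ?_, ?_⟩
    · exact Polynomial.monic_X_pow_add (lt_of_le_of_lt Polynomial.degree_linear_le (by
        exact_mod_cast Nat.lt_succ_self 1))
    · rw [Polynomial.eval₂_add, Polynomial.eval₂_add, Polynomial.eval₂_mul, Polynomial.eval₂_pow,
        Polynomial.eval₂_X, Polynomial.eval₂_C, Polynomial.eval₂_C]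
      change z ^ 2 + (Φ (-algebraMap u.Completion _ y₁) * z + Φ (algebraMap u.Completion _ y₂)) = 0
      rw [map_neg, hΦK, hΦK, hy₁, hy₂, Complex.normSq_eq_conj_mul_self]
      have : ((2 * z.re : ℝ) : ℂ) = z + starRingEnd ℂ z := (Complex.add_conj z).symm
      rw [this]
      ring
  exact (IsAlgClosed.ringHom_bijective_of_isIntegral Φ.toRingHom hint).2

omit [IsGalois K E] [NumberField E] [NumberField K] in
/-- **Positivity of norms from a quadratic extension of a real completion.**  Let `u` be a real
place of `K`, `a ∈ Kˣ`, and suppose that inside `K̄_u` we have `a = ∏_{k<n} sᵏ • b` (`b ≠ 0`) for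
some `s ∈ Γ_{K_u}` whose powers `sᵏ`, `k < n`, lie in a subgroup `U` only for `k = 0`, with
`n ≥ 2`.  Then `u(a) > 0`.  (Transport to `ℂ` along a `K_u`-isomorphism `Φ : K̄_u ≅ ℂ` over the
embedding of `u`: `Φ s Φ⁻¹` is an `ℝ`-automorphism of `ℂ`, not the identity, hence complex
conjugation; so `s² = 1`, `n = 2` and `u(a) = Φ(b) · conj Φ(b) = |Φ(b)|² > 0`.) [folklore] -/
theorem embedding_re_pos_of_prod_smul_eq {u : InfinitePlace K} (a : Kˣ) {n : ℕ}
    (hn : 2 ≤ n) (s : Field.absoluteGaloisGroup u.Completion) (b : AlgebraicClosure u.Completion)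
    (hb0 : b ≠ 0) (U : Subgroup (Field.absoluteGaloisGroup u.Completion))
    (hinj : ∀ k < n, s ^ k ∈ U → k = 0)
    (hprod : ∏ k ∈ Finset.range n, (s ^ k) • b =
      absClosureEmbedding K u.Completion (algebraMap K (AlgebraicClosure K) (a : K))) :
    0 < (u.embedding (a : K)).re := by
  classical
  letI : Algebra u.Completion ℂ := (Completion.extensionEmbedding u).toAlgebra
  let Φ : AlgebraicClosure u.Completion →ₐ[u.Completion] ℂ := IsAlgClosed.lift
  have hΦK : ∀ y : u.Completion, Φ (algebraMap u.Completion _ y) = Completion.extensionEmbedding u y :=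
    fun y => Φ.commutes y
  have hΦinj : Function.Injective Φ := Φ.toRingHom.injective
  have hΦsurj : Function.Surjective Φ := surjective_algHom_complex u Φ
  -- conjugation by `Φ`: `Ψ_d = Φ ∘ d ∘ Φ⁻¹` is an `ℝ`-algebra endomorphism of `ℂ`
  have hΨ : ∀ d : Field.absoluteGaloisGroup u.Completion,
      (∀ x, Φ (d • x) = Φ x) ∨ (∀ x, Φ (d • x) = starRingEnd ℂ (Φ x)) := by
    intro d
    let ΦE : AlgebraicClosure u.Completion ≃+* ℂ := RingEquiv.ofBijective Φ.toRingHom ⟨hΦinj, hΦsurj⟩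
    have hΦE : ∀ x, ΦE x = Φ x := fun x => rfl
    set dA : AlgebraicClosure u.Completion ≃ₐ[u.Completion] AlgebraicClosure u.Completion :=
      Field.absoluteGaloisGroup.toAlgEquiv u.Completion d with hdA
    have hdx : ∀ x, d • x = dA x := fun x => rfl
    let Ψ : ℂ →ₐ[ℝ] ℂ :=
      { toRingHom := ΦE.toRingHom.comp (dA.toRingEquiv.toRingHom.comp ΦE.symm.toRingHom)
        commutes' := fun r => by
          obtain ⟨y, hy⟩ := exists_extensionEmbedding_eq_ofReal u r
          change ΦE (dA (ΦE.symm (algebraMap ℝ ℂ r))) = algebraMap ℝ ℂ r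
          have hr : algebraMap ℝ ℂ r = ΦE (algebraMap u.Completion _ y) := by
            rw [hΦE, hΦK, hy]; rfl
          rw [hr, RingEquiv.symm_apply_apply, AlgEquiv.commutes] }
    have hΨapply : ∀ x, Ψ (Φ x) = Φ (d • x) := by
      intro x
      change ΦE (dA (ΦE.symm (Φ x))) = Φ (d • x)
      rw [← hΦE x, RingEquiv.symm_apply_apply, hdx, hΦE]
    rcases Complex.real_algHom_eq_id_or_conj Ψ with hid | hconj
    · left
      intro x
      rw [← hΨapply, hid]
      rfl
    · right
      intro x
      rw [← hΨapply, hconj]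
      rfl
  -- for `s`: not the identity, hence conjugation
  have hs : ∀ x, Φ (s • x) = starRingEnd ℂ (Φ x) := by
    rcases hΨ s with hid | hconj
    · exfalso
      have hs1 : s = 1 := by
        apply AlgEquiv.ext
        intro x
        exact hΦinj (hid x)
      have := hinj 1 (by omega) (by rw [pow_one, hs1]; exact U.one_mem)
      exact one_ne_zero this
    · exact hconj
  -- hence `s² = 1` and `n = 2`
  have hs2 : s ^ 2 = 1 := by
    apply AlgEquiv.ext
    intro x
    apply hΦinj
    change Φ ((s * s) • x) = Φ x
    rw [mul_smul, hs, hs, starRingEnd_self_apply]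
  have hn2 : n = 2 := by
    by_contra hne
    have h2 : 2 < n := lt_of_le_of_ne hn (Ne.symm hne)
    have := hinj 2 h2 (by rw [hs2]; exact U.one_mem)
    exact two_ne_zero this
  subst hn2
  -- `u(a) = Φ(b) · conj Φ(b)`
  rw [Finset.prod_range_succ, Finset.prod_range_succ, Finset.prod_range_zero, one_mul, pow_zero,
    one_smul, pow_one] at hprod
  have hΦa : Φ (absClosureEmbedding K u.Completion (algebraMap K (AlgebraicClosure K) (a : K))) =
      u.embedding (a : K) := by
    rw [AlgHom.commutes, show algebraMap K (AlgebraicClosure u.Completion) (a : K) =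
      algebraMap u.Completion (AlgebraicClosure u.Completion) (algebraMap K u.Completion (a : K)) from
        IsScalarTower.algebraMap_apply K u.Completion _ (a : K), hΦK]
    exact extensionEmbedding_coe' u (a : K)
  have hkey : (u.embedding (a : K) : ℂ) = Φ b * starRingEnd ℂ (Φ b) := by
    rw [← hΦa, ← hprod, map_mul, hs]
  have hb' : Φ b ≠ 0 := (map_ne_zero_iff _ hΦinj).mpr hb0
  have hre : (u.embedding (a : K)).re = Complex.normSq (Φ b) := by
    rw [hkey, Complex.mul_conj]
    simp
  rw [hre]
  exact Complex.normSq_pos.mpr hb'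

/-! ### The archimedean local condition from the cohomological data -/

/-- **The archimedean local condition of Hasse's norm theorem, from a norm over the layer of `K̄_u`
cut out by `E`.**  Let `u` be an infinite place of `K`, `a ∈ Kˣ`, and suppose that inside `K̄_u`
(with the chosen `K̄ → K̄_u` and the compositum `K_u(E)`) `a = ∏_{k<n} sᵏ • b` with `b ∈ K_u(E)` and
the `sᵏ`, `k < n`, representing `Γ_{K_u} / Gal(K̄_u/K_u(E))` exactly once.  Then the part of `(a)_∞`
above `u` is a Galois norm from `∏_{w∣u} E_wˣ`: if `u` is complex, or `n = 1` (i.e. `K_u(E) = K_u`,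
`forall_isUnramified_of_forall_mem_range`), the places above `u` are unramified and form a free
orbit; if `u` is real and `n ≥ 2` then `u(a) > 0` (`embedding_re_pos_of_prod_smul_eq`) and positive
reals are norms. [cite: CasselsFrohlichANT1967, Ch. VII §9.6; Ch. II §10] -/
theorem exists_infUnits_norm_eq_of_local (u : InfinitePlace K) (ιE : E →ₐ[K] AlgebraicClosure K)
    (a : Kˣ) (n : ℕ) (s : Field.absoluteGaloisGroup u.Completion) (b : AlgebraicClosure u.Completion)
    (hcov : ∀ d : Field.absoluteGaloisGroup u.Completion, ∃ k < n,
      (s ^ k)⁻¹ * d ∈ LocalWeilDatum.galFixing u.Completion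
        (IntermediateField.adjoin u.Completion (Set.range ((absClosureEmbedding K u.Completion).comp ιE))))
    (hinj : ∀ k < n, s ^ k ∈ LocalWeilDatum.galFixing u.Completion
        (IntermediateField.adjoin u.Completion (Set.range ((absClosureEmbedding K u.Completion).comp ιE))) →
      k = 0)
    (hprod : ∏ k ∈ Finset.range n, (s ^ k) • b =
      absClosureEmbedding K u.Completion (algebraMap K (AlgebraicClosure K) (a : K))) :
    ∃ Y ∈ infUnits E u, Herbrand.norm (E ≃ₐ[K] E) Y =
      restrictTo (F := K) u (infHom E (principal E (CyclicNormIndex.unitsIncl K E a))) := by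
  classical
  refine exists_infUnits_norm_eq_restrictTo_principal u a ?_
  -- `n ≠ 0`
  have hn0 : n ≠ 0 := by
    rintro rfl
    obtain ⟨k, hk, -⟩ := hcov 1
    exact Nat.not_lt_zero k hk
  rcases u.isReal_or_isComplex with hu | hu
  · by_cases hn : 2 ≤ n
    · -- real place, non-trivial layer: `u(a) > 0`
      right
      have ha0 : absClosureEmbedding K u.Completion (algebraMap K (AlgebraicClosure K) (a : K)) ≠ 0 := by
        intro h
        apply a.ne_zero
        have h1 : algebraMap K (AlgebraicClosure K) (a : K) = 0 :=
          (absClosureEmbedding K u.Completion).toRingHom.injective (by rw [map_zero]; exact h)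
        exact (algebraMap K (AlgebraicClosure K)).injective (by rw [map_zero]; exact h1)
      have hb0 : b ≠ 0 := by
        intro hb0
        apply ha0
        rw [← hprod, Finset.prod_eq_zero (Finset.mem_range.mpr (Nat.pos_of_ne_zero hn0))]
        rw [pow_zero, one_smul, hb0]
      exact ⟨hu, embedding_re_pos_of_prod_smul_eq a hn s b hb0 _ hinj hprod⟩
    · -- `n = 1`: `K_u(E) = K_u`, all places above `u` are unramified
      left
      have hn1 : n = 1 := by omega
      subst hn1
      have htop : ∀ d : Field.absoluteGaloisGroup u.Completion,
          d ∈ LocalWeilDatum.galFixing u.Completion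
            (IntermediateField.adjoin u.Completion
              (Set.range ((absClosureEmbedding K u.Completion).comp ιE))) := by
        intro d
        obtain ⟨k, hk, hmem⟩ := hcov d
        have hk0 : k = 0 := by omega
        rw [hk0, pow_zero, inv_one, one_mul] at hmem
        exact hmem
      haveI : CharZero u.Completion := charZero_of_injective_algebraMap (algebraMap K _).injective
      haveI : IsGalois u.Completion (AlgebraicClosure u.Completion) := IsGalois.mk
      refine forall_isUnramified_of_forall_mem_range u ιE fun e => ?_
      have hfix : ∀ g : AlgebraicClosure u.Completion ≃ₐ[u.Completion] AlgebraicClosure u.Completion,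
          g (absClosureEmbedding K u.Completion (ιE e)) = absClosureEmbedding K u.Completion (ιE e) :=
        fun g => (LocalWeilDatum.mem_galFixing_iff u.Completion).mp (htop g) _
          (IntermediateField.subset_adjoin _ _ ⟨e, rfl⟩)
      have hmem : absClosureEmbedding K u.Completion (ιE e) ∈
          (⊥ : IntermediateField u.Completion (AlgebraicClosure u.Completion)) := by
        rw [← InfiniteGalois.fixedField_fixingSubgroup (⊥ : IntermediateField u.Completion
          (AlgebraicClosure u.Completion)), IntermediateField.fixingSubgroup_bot,
          IntermediateField.mem_fixedField_iff]
        exact fun g _ => hfix g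
      exact IntermediateField.mem_bot.mp hmem
  · -- complex place: every place above it is unramified
    left
    intro w hw
    rw [isUnramified_iff]
    right
    rwa [show w.comap (algebraMap K E) = u from hw]

end ArchHerbrand

end Literature.NumberTheory.GaloisRepresentations
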